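/-
Copyright (c) 2026 the pub-hodgecm-mathlib formalisation cell (harness21).  Prover seat hodgecm-mathlib-K2Liu-p12 (g6), Track B «K2-LIT»,
#184♮ = hLiu418 = `stmt-HodgeConjecture-24832`; #42S block D, row D-2, (σ-A) mini-road ((σ-A) road desk K2Liu-p25 (g3) WORD #53∕#54: brick (B2-coord)),
FILE A «QUADRATIC-COORDINATE BLOCK ACTION».  THEOREMS ONLY (no `def`, no `instance`, no `notation`, no named-fact hypothesis, no `sorry`).
-/
import Literature.NumberTheory.Automorphic.QuadraticRestrictionOfScalars   -- ★ `IsQuadraticCoordinates`, `QuadraticCoordinates.{re, im, coords}`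
import Mathlib.LinearAlgebra.Matrix.Reindex
import HarnessLib

/-!
# Crux `HLiu418`, #42S block D row D-2, (σ-A) brick (B2-coord) FILE A `K2LiuQuadraticCoordinateBlockAction`:
# `E`-SCALAR MULTIPLICATION IN QUADRATIC COORDINATES IS ★ p864769's `hZm`, AND THE FIRST-COLUMN ACTION OF `G ⊗ₖ 1`

Cell `hodgecm-mathlib`, crux item hLiu418 = `stmt-HodgeConjecture-24832`; lane `--supports stmt-HodgeConjecture-24832 --as helper` (count-neutral helper).

WHAT (generic algebra, any `IsQuadraticCoordinates φ Ψ δ d` over commutative rings `R → S`; at the record `R := L⁺_v`, `S := E_w`∕`∏_{w∣v} E_w`,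
`Ψ := quadraticLocalEquiv`).  K2Liu-p09's (B2-read) reads the Siegel–Levi prefix `p(ζ) ⊗ 1` of the cone word on the `E_w`-coordinates of the position
(slots `epsV (a, i)`: `𝕍`-slot `a : Fin 2`, `V′`-slot `i`) as the matrix `reindex epsV (G_ζ ⊗ₖ 1)`; (B2-coord) must turn that into ★ p864562's graph
`Zm` in the BOX coordinates of the Schrödinger model.  THIS FILE is the convention-free algebra of that step:
* §1 **`re_smul_apply` ∕ `im_smul_apply`** (★ `re_mul`∕`im_mul` reassociated): `re (z·x_i) = re z·re x_i + d·im z·im x_i`, `im (z·x_i) = re z·im x_i + im z·re x_i` — `E`-scalar multiplication in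
  `(re, im)` pairs; `re_map_smul_apply` ∕ `im_map_smul_apply` (`φ λ` acts by `λ`); and THE `hZm` DOCK **`hZm_of_pair_mul`**: if a graph `Zm` satisfies the
  `E`-level identity `Ψ (Zm s ζ (eJ (l,0)), Zm s ζ (eJ (l,1))) = Ψ (ζ 0, ζ 1) · Ψ (s (eJ′ (l,0)), s (eJ′ (l,1)))` («slot pair `l` of `Zm s ζ` is `ζ_E` times slot
  pair `l` of `s`») then it satisfies ★ p864769 `K2LiuConeChartFrames`' letter `hZm` at `d` VERBATIM.
* §2 **`reindex_kronecker_one_mulVec_apply`**: `(reindex ε ε (G ⊗ₖ 1) *ᵥ y) k = Σ_a G (ε⁻¹k).1 a · y (ε (a, (ε⁻¹k).2))`, and on a vector supported on ONE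
  `𝕍`-slot `i₀` (`reindex_kronecker_one_mulVec_slot`) the `a`-slot of the image is `G a i₀ • x` — the FIRST COLUMN of `G` acts; with §1 this is the point
  formula's shape `(x₁ ⊔ 0) ↦ (G⁻¹_{i₀i₀}·x₁ ⊔ G⁻¹_{i₁i₀}·x₁)`.
[cite: HarrisKudlaSweet1996, §1 (1.11)–(1.12)] [cite: Kudla1994, §3 Thm. 3.1] [cite: MoeglinVignerasWaldspurger1987, Chap. 2 II.6]
HONEST LABEL.  Count-neutral helper; it retires nothing by itself: `HC_CM` is proved only modulo the 7 printed citations (2 remaining named inputs: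
hLiu418 = `stmt-HodgeConjecture-24832`, h413 = `stmt-HodgeConjecture-24833`) until rung 0 closes.

## References
* [HarrisKudlaSweet1996] M. Harris, S. Kudla, W. J. Sweet, *Theta dichotomy for unitary groups*, J. AMS 9 (1996), §1 (1.11)–(1.12).
* [Kudla1994] S. S. Kudla, *Splitting metaplectic covers of dual reductive pairs*, Israel J. Math. 87 (1994), §3 Thm. 3.1.
* [MoeglinVignerasWaldspurger1987] C. Mœglin, M.-F. Vignéras, J.-L. Waldspurger, LNM 1291 (1987), Chap. 2 II.6.
-/

set_option autoImplicit false
set_option linter.dupNamespace false -- the mandated namespace repeats `HodgeConjecture.HodgeConjecture`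

open Matrix
open scoped Kronecker
open Literature.NumberTheory.Automorphic.UnitaryGroup Literature.NumberTheory.Automorphic.UnitaryGroup.QuadraticCoordinates

namespace Summit.HodgeConjecture.HodgeConjecture.Cruxes.HLiu418.K2LiuQuadraticCoordinateBlockAction

/-! ## §1 `E`-scalar multiplication in `(re, im)` pairs; the `hZm` dock -/

section Scalar

variable {R S : Type*} [CommRing R] [CommRing S] {φ : R →+* S} {Ψ : (R × R) ≃+ S} {δ : S} {d : R}
  (h : IsQuadraticCoordinates φ Ψ δ d)

include h in
/-- `re (z · w) = re z · re w + d · im z · im w` (★ `re_mul`, reassociated to ★ p864769's `hZm` byte shape). [cite: HarrisKudlaSweet1996, §1 (1.11)] -/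
theorem re_mul' (z w : S) : re Ψ (z * w) = re Ψ z * re Ψ w + d * im Ψ z * im Ψ w := by
  rw [h.re_mul, mul_assoc]

include h in
/-- **`E`-SCALAR MULTIPLICATION IN QUADRATIC COORDINATES, `re`-part**: `re ((z • x) i) = re z · re (x i) + d · im z · im (x i)`. [cite: HarrisKudlaSweet1996, §1 (1.11)] -/
theorem re_smul_apply {ι : Type*} (z : S) (x : ι → S) (i : ι) :
    re Ψ ((z • x) i) = re Ψ z * re Ψ (x i) + d * im Ψ z * im Ψ (x i) := by
  rw [Pi.smul_apply, smul_eq_mul, re_mul' h]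

include h in
/-- **… `im`-part**: `im ((z • x) i) = re z · im (x i) + im z · re (x i)`. [cite: HarrisKudlaSweet1996, §1 (1.11)] -/
theorem im_smul_apply {ι : Type*} (z : S) (x : ι → S) (i : ι) :
    im Ψ ((z • x) i) = re Ψ z * im Ψ (x i) + im Ψ z * re Ψ (x i) := by
  rw [Pi.smul_apply, smul_eq_mul, h.im_mul]

include h in
/-- a REAL scalar `φ λ` acts on both coordinates by `λ`: `re ((φ λ • x) i) = λ · re (x i)`. [cite: HarrisKudlaSweet1996, §1 (1.11)] -/
theorem re_map_smul_apply {ι : Type*} (c : R) (x : ι → S) (i : ι) : re Ψ ((φ c • x) i) = c * re Ψ (x i) := by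
  rw [Pi.smul_apply, smul_eq_mul, h.re_mul, h.re_map, h.im_map, zero_mul, mul_zero, add_zero]

include h in
/-- … and `im ((φ λ • x) i) = λ · im (x i)`. [cite: HarrisKudlaSweet1996, §1 (1.11)] -/
theorem im_map_smul_apply {ι : Type*} (c : R) (x : ι → S) (i : ι) : im Ψ ((φ c • x) i) = c * im Ψ (x i) := by
  rw [Pi.smul_apply, smul_eq_mul, h.im_mul, h.re_map, h.im_map, zero_mul, add_zero]

include h in
/-- `Ψ (a, b) · Ψ (a′, b′)` in coordinates: `re = a a′ + d b b′`, `im = a b′ + b a′`. [cite: HarrisKudlaSweet1996, §1 (1.11)] -/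
theorem re_im_pair_mul (a b a' b' : R) :
    re Ψ (Ψ (a, b) * Ψ (a', b')) = a * a' + d * b * b' ∧ im Ψ (Ψ (a, b) * Ψ (a', b')) = a * b' + b * a' := by
  rw [re_mul' h, h.im_mul, re_apply, im_apply, re_apply, im_apply]
  exact ⟨rfl, rfl⟩

include h in
/-- **THE `hZm` DOCK.**  A graph `Zm : (ι₁′ → R) → ((Fin 2 → R) →ₗ[R] (ι₁ → R))` whose slot pair `l` (slots `eJ (l, 0)`, `eJ (l, 1)`) is, as an element of
`S`, the product `ζ_E · s_{E,l}` of `ζ_E := Ψ (ζ 0, ζ 1)` with the slot pair `l` of `s` (slots `eJ′ (l, 0)`, `eJ′ (l, 1)`), satisfies ★ p864769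
`K2LiuConeChartFrames`' coordinate letter `hZm` at `d` VERBATIM. [cite: HarrisKudlaSweet1996, §1 (1.11)–(1.12)] -/
theorem hZm_of_pair_mul {n : ℕ} {ι₁ ι₁' : Type*} (eJ : Fin n × Fin 2 ≃ ι₁) (eJ' : Fin n × Fin 2 ≃ ι₁')
    (Zm : (ι₁' → R) → ((Fin 2 → R) →ₗ[R] (ι₁ → R)))
    (hZE : ∀ (s : ι₁' → R) (ζ : Fin 2 → R) (l : Fin n),
      Ψ (Zm s ζ (eJ (l, 0)), Zm s ζ (eJ (l, 1))) = Ψ (ζ 0, ζ 1) * Ψ (s (eJ' (l, 0)), s (eJ' (l, 1)))) :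
    ∀ (s : ι₁' → R) (ζ : Fin 2 → R) (j : Fin n),
      Zm s ζ (eJ (j, 0)) = ζ 0 * s (eJ' (j, 0)) + d * ζ 1 * s (eJ' (j, 1)) ∧
      Zm s ζ (eJ (j, 1)) = ζ 0 * s (eJ' (j, 1)) + ζ 1 * s (eJ' (j, 0)) := by
  intro s ζ j
  have hre := congrArg (re Ψ) (hZE s ζ j)
  have him := congrArg (im Ψ) (hZE s ζ j)
  rw [re_apply, (re_im_pair_mul h _ _ _ _).1] at hre
  rw [im_apply, (re_im_pair_mul h _ _ _ _).2] at him
  exact ⟨hre, him⟩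

end Scalar

/-! ## §2 The first-column action of `reindex ε (G ⊗ₖ 1)` -/

section Kronecker

variable {S : Type*} [CommRing S] {ι κ : Type*} [Fintype ι] [DecidableEq ι] [Fintype κ] (ε : Fin 2 × ι ≃ κ)

/-- **`(reindex ε ε (G ⊗ₖ 1) *ᵥ y) k = Σ_a G (ε⁻¹k).1 a · y (ε (a, (ε⁻¹k).2))`**: a `2 × 2` matrix over `S` tensored with `1_{V′}` acts on the `𝕍`-slot index only.
[cite: Kudla1994, §3 Thm. 3.1] -/
theorem reindex_kronecker_one_mulVec_apply (G : Matrix (Fin 2) (Fin 2) S) (y : κ → S) (k : κ) :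
    (Matrix.reindex ε ε (G ⊗ₖ (1 : Matrix ι ι S)) *ᵥ y) k = ∑ a : Fin 2, G (ε.symm k).1 a * y (ε (a, (ε.symm k).2)) := by
  rw [Matrix.mulVec, dotProduct, ← Fintype.sum_equiv ε (fun p => Matrix.reindex ε ε (G ⊗ₖ (1 : Matrix ι ι S)) k (ε p) * y (ε p)) _ (fun _ => rfl),
    Fintype.sum_prod_type]
  refine Finset.sum_congr rfl fun a _ => ?_
  simp only [Matrix.reindex_apply, Matrix.submatrix_apply, Equiv.symm_apply_apply, Matrix.kroneckerMap_apply, Matrix.one_apply, mul_ite,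
    mul_one, mul_zero, ite_mul, zero_mul]
  rw [Finset.sum_ite_eq Finset.univ (ε.symm k).2 (fun i => G (ε.symm k).1 a * y (ε (a, i)))]
  simp

/-- **ON A VECTOR SUPPORTED ON ONE `𝕍`-SLOT `i₀` THE FIRST COLUMN ACTS**: if `y (ε (a, i)) = x i` for `a = i₀` and `0` otherwise, then
`(reindex ε ε (G ⊗ₖ 1) *ᵥ y) (ε (a, i)) = G a i₀ · x i`. [cite: Kudla1994, §3 Thm. 3.1] [cite: MoeglinVignerasWaldspurger1987, Chap. 2 II.6] -/
theorem reindex_kronecker_one_mulVec_slot (G : Matrix (Fin 2) (Fin 2) S) (i₀ : Fin 2) (x : ι → S) (y : κ → S)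
    (hy : ∀ (a : Fin 2) (i : ι), y (ε (a, i)) = if a = i₀ then x i else 0) (a : Fin 2) (i : ι) :
    (Matrix.reindex ε ε (G ⊗ₖ (1 : Matrix ι ι S)) *ᵥ y) (ε (a, i)) = G a i₀ * x i := by
  rw [reindex_kronecker_one_mulVec_apply, Equiv.symm_apply_apply]
  simp only [hy, mul_ite, mul_zero, Finset.sum_ite_eq', Finset.mem_univ, if_true]

/-- the same, read as slot pairs: the image's `𝕍`-slot `a` is the `V′`-vector `G a i₀ • x`. [cite: Kudla1994, §3 Thm. 3.1] -/
theorem reindex_kronecker_one_mulVec_slot_eq_smul (G : Matrix (Fin 2) (Fin 2) S) (i₀ : Fin 2) (x : ι → S) (y : κ → S)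
    (hy : ∀ (a : Fin 2) (i : ι), y (ε (a, i)) = if a = i₀ then x i else 0) (a : Fin 2) :
    (fun i => (Matrix.reindex ε ε (G ⊗ₖ (1 : Matrix ι ι S)) *ᵥ y) (ε (a, i))) = G a i₀ • x :=
  funext fun i => by rw [reindex_kronecker_one_mulVec_slot ε G i₀ x y hy, Pi.smul_apply, smul_eq_mul]

end Kronecker

end Summit.HodgeConjecture.HodgeConjecture.Cruxes.HLiu418.K2LiuQuadraticCoordinateBlockAction
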